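import Summits.BirchSwinnertonDyer.BirchSwinnertonDyer.Theorems.CMKolyvaginAtInertTwoPairDataInputsAtTwo
import HarnessLib

/-!
# Route `CMKolyvaginAtInertTwo`, crux `CMKolyvaginExactAtInertTwo` (stmt-BirchSwinnertonDyer-24277):
# THE EXACT-EIGENVECTOR NORMALISATION OF `x₀` (for the `ℚ`-Selmer carrier of T2)

Seat `bsd-line-cmk2-p1` g14 (cell `bsd-print-cf2`); helper (`--supports stmt-BirchSwinnertonDyer-24277`).
THEOREMS ONLY: no definition, no named fact, no `sorry`; no item is closed; BSD is not proved by this.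

WHY (KERNEL-STATUS §13, T2 design). The Cassels–Tate value formula `hCTV` of the adaptive telescope
must be built from the two pairings OVER `ℚ` (§12.2), so the telescope has to run on the sub-carrier
of `pairData` whose classes descend to classes SELMER over `ℚ` (for `E` on the `ε`-side, for the
twist `E^{(d_K)}` on the other side). For the class `x = δ x₀` (`2^{M₀} x₀ = y_K`) this needs `x₀`
to be — up to a `2^M`-divisible error, invisible to `δ` — an EXACT `ε`-eigenvector of the conjugation
`c` of `K`, i.e. a point of `E^{ε}(ℚ) ⊆ E(K)`; the point system only gives `c x₀ − ε x₀` torsion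
(Gross Prop. 5.3 at `m = 1` descended to `x₀`: `conjAct_kummerMapTorsion_eq_smul_of_isOfFinAddOrder`,
p679335). On the habitat `E(K)[2] = 0`, so that torsion point `t` has ODD order `m`, and
`c t = −ε t` (`c² = 1`); then `x₁ := x₀ + u t` with `2εu ≡ 1 (mod m)` is an exact eigenvector and
`x₁ − x₀ = u t` is `2^M`-divisible:

* `map_conj_conj` — `c (c P) = P` on `E(K)` for `c² = 1`;
* `exists_conj_eq_smul_sub_divisible` — `∃ x₁, c x₁ = ε x₁ ∧ ∃ R, 2^M R = x₁ − x₀`;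
* `exists_conj_eq_smul_kummerMapTorsion_eq` — hence `∃ x₁, c x₁ = ε x₁ ∧ δ x₁ = δ x₀` at level `2^M`.

References: [GrossLMS1991] Prop. 5.3, §4 (4.1); [McCallumLMS1991] §5 (the pair `(E, E^D)` over `ℚ`
via [Kolyvagin1989Izv] §3).
-/

-- single-conjunct summit: `Summit.BirchSwinnertonDyer.BirchSwinnertonDyer.…` repeats the name by design
set_option linter.dupNamespace false
set_option autoImplicit false

noncomputable section

open scoped Classical
open WeierstrassCurve NumberField
open Literature.NumberTheory.GaloisRepresentations
open Literature.NumberTheory.EllipticCurves Literature.NumberTheory.EllipticCurves.KolyvaginDescent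

namespace Summit.BirchSwinnertonDyer.BirchSwinnertonDyer.Theorems.KolyvaginPairDataTwo

section Normalisation

variable (W : WeierstrassCurve ℚ) {K : Type} [Field K] [NumberField K]

/-- For `c ∈ Aut(K/ℚ)` with `c² = 1`, the induced map on `E(K)` is an involution: `c (c P) = P`.
[folklore] -/
theorem map_conj_conj {c : K ≃ₐ[ℚ] K} (hcc : c * c = 1) (P : (W.baseChange K).toAffine.Point) :
    Affine.Point.map (W' := W) (c : K →ₐ[ℚ] K) (Affine.Point.map (W' := W) (c : K →ₐ[ℚ] K) P) = P := by
  have hcomp : (c : K →ₐ[ℚ] K).comp (c : K →ₐ[ℚ] K) = AlgHom.id ℚ K := by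
    ext k
    change c (c k) = k
    rw [← AlgEquiv.mul_apply, hcc, AlgEquiv.one_apply]
  rw [Affine.Point.map_map, hcomp]
  cases P <;> rfl

/-- **Exact-eigenvector normalisation.** If `E(K)` has no `2`-torsion, `c² = 1`, `ε = ±1` and
`c x₀ − ε x₀` is torsion, then some `x₁` with `c x₁ = ε x₁` EXACTLY differs from `x₀` by a
`2^M`-divisible point (namely `x₁ = x₀ + u t`, `t = c x₀ − ε x₀` of odd order `m`, `2εu ≡ 1 (m)`;
`c t = −ε t`). [folklore] -/
theorem exists_conj_eq_smul_sub_divisible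
    (h2 : ∀ T : (W.baseChange K).toAffine.Point, (2 : ℤ) • T = 0 → T = 0)
    {c : K ≃ₐ[ℚ] K} (hcc : c * c = 1) {ε : ℤ} (hε : ε = 1 ∨ ε = -1)
    {x₀ : (W.baseChange K).toAffine.Point}
    (htor : IsOfFinAddOrder (Affine.Point.map (W' := W) (c : K →ₐ[ℚ] K) x₀ - ε • x₀)) (M : ℕ) :
    ∃ x₁ : (W.baseChange K).toAffine.Point,
      Affine.Point.map (W' := W) (c : K →ₐ[ℚ] K) x₁ = ε • x₁ ∧
      ∃ R : (W.baseChange K).toAffine.Point, ((2 : ℤ) ^ M) • R = x₁ - x₀ := by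
  set t := Affine.Point.map (W' := W) (c : K →ₐ[ℚ] K) x₀ - ε • x₀ with ht_def
  have hε2 : ε * ε = 1 := by rcases hε with rfl | rfl <;> norm_num
  -- `c t = −ε t`
  have hct : Affine.Point.map (W' := W) (c : K →ₐ[ℚ] K) t = -(ε • t) := by
    rw [ht_def, map_sub, map_zsmul, map_conj_conj W hcc, zsmul_sub, smul_smul, hε2, one_smul]
    abel
  -- `m = ord t` is odd; `k` with `2k ≡ 1 (mod m)`
  set m := addOrderOf t with hm_def
  have hmodd : Odd m := odd_addOrderOf_of_isOfFinAddOrder h2 htor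
  have hmpos : 0 < m := htor.addOrderOf_pos
  obtain ⟨k, hk⟩ : ∃ k : ℤ, (m : ℤ) ∣ 2 * k - 1 := by
    obtain ⟨j, hj⟩ := hmodd
    exact ⟨j + 1, ⟨1, by push_cast [hj]; ring⟩⟩
  -- `x₁ = x₀ + (ε k) • t`
  refine ⟨x₀ + (ε * k) • t, ?_, ?_⟩
  · -- exact eigenvector: `c x₀ + εk c t = ε x₀ + t − k t·… `
    have hx₀ : Affine.Point.map (W' := W) (c : K →ₐ[ℚ] K) x₀ = ε • x₀ + t := by
      rw [ht_def]; abel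
    rw [map_add, map_zsmul, hct, hx₀, zsmul_add, smul_smul, smul_neg, smul_smul,
      show ε * (ε * k) = k by rw [← mul_assoc, hε2, one_mul]]
    -- goal: `ε • x₀ + t + -((ε * k * ε) • t) = ε • x₀ + k • t`... normalise `ε k ε = k`
    have hkk : ε * k * ε = k := by rw [mul_comm, ← mul_assoc, hε2, one_mul]
    rw [hkk]
    -- `t - k t = k t` iff `(2k - 1) t = 0`
    have hvan : (2 * k - 1) • t = 0 := by
      obtain ⟨q, hq⟩ := hk
      rw [hq, mul_comm, mul_zsmul, natCast_zsmul, addOrderOf_nsmul_eq_zero, zsmul_zero]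
    have : t + -(k • t) = k • t := by
      rw [← sub_eq_zero]
      have : t + -(k • t) - k • t = -((2 * k - 1) • t) := by
        rw [sub_zsmul, mul_zsmul, one_zsmul, two_zsmul]; abel
      rw [this, hvan, neg_zero]
    rw [add_assoc, this]
  · -- `x₁ − x₀ = (εk) • t` is torsion of odd order, hence `2^M`-divisible
    have htor' : IsOfFinAddOrder ((ε * k) • t) := htor.zsmul
    obtain ⟨u, hu⟩ := exists_two_pow_zsmul_eq_of_isOfFinAddOrder h2 htor' M
    exact ⟨u • ((ε * k) • t), by rw [hu, add_sub_cancel_left]⟩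

/-- **Same Kummer class.** Under the same hypotheses, with `E(K̄)` `2^M`-divisible (`hdiv`): there is
an exact `ε`-eigenvector `x₁` (`c x₁ = ε x₁`) with `δ x₁ = δ x₀` in `H¹(K, E[2^M])` — so the class
`x = δ x₀` of the telescope is the restriction of the Kummer class of a point of `E^{ε}(ℚ) ⊆ E(K)`.
[cite: GrossLMS1991, Prop. 5.3 and §4 (4.1)] -/
theorem exists_conj_eq_smul_kummerMapTorsion_eq
    (h2 : ∀ T : (W.baseChange K).toAffine.Point, (2 : ℤ) • T = 0 → T = 0)
    {c : K ≃ₐ[ℚ] K} (hcc : c * c = 1) {ε : ℤ} (hε : ε = 1 ∨ ε = -1) {M : ℕ}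
    (hdiv : ∀ Q : geomPoints (W.baseChange K), ∃ R, ((2 ^ M : ℕ) : ℤ) • R = Q)
    {x₀ : (W.baseChange K).toAffine.Point}
    (htor : IsOfFinAddOrder (Affine.Point.map (W' := W) (c : K →ₐ[ℚ] K) x₀ - ε • x₀)) :
    ∃ x₁ : (W.baseChange K).toAffine.Point,
      Affine.Point.map (W' := W) (c : K →ₐ[ℚ] K) x₁ = ε • x₁ ∧
      kummerMapTorsion (W.baseChange K) _ hdiv x₁ = kummerMapTorsion (W.baseChange K) _ hdiv x₀ := by
  obtain ⟨x₁, hx₁, R, hR⟩ := exists_conj_eq_smul_sub_divisible W h2 hcc hε htor M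
  refine ⟨x₁, hx₁, ?_⟩
  rw [← sub_eq_zero, ← map_sub, ← hR, show ((2 : ℤ) ^ M) = ((2 ^ M : ℕ) : ℤ) by push_cast; ring,
    map_zsmul]
  exact zsmul_galH1Torsion_eq_zero _ _ _

end Normalisation

end Summit.BirchSwinnertonDyer.BirchSwinnertonDyer.Theorems.KolyvaginPairDataTwo
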